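import Mathlib.RingTheory.AdjoinRoot
import Mathlib.Algebra.Polynomial.Expand
import Mathlib.FieldTheory.Finite.Basic
import Mathlib.LinearAlgebra.Trace
import Mathlib.LinearAlgebra.Matrix.ToLin
import Mathlib.LinearAlgebra.StdBasis
import Mathlib.RingTheory.Nilpotent.Defs
import Mathlib.RingTheory.RootsOfUnity.Basic
import Mathlib.FieldTheory.Finite.GaloisField
import Mathlib.Algebra.GroupWithZero.Units.Fintype
import Mathlib.Data.Nat.Factorization.Basic
import Mathlib.Analysis.Complex.Basic
import Literature.NumberTheory.BostConnes.FiniteLevels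
import HarnessLib

/-!
# Barrier: reduced Λ-rings of finite rank are sub-Λ-rings of `ℤ[μ_r]ⁿ` — zero-dimensional `𝔽₁`-schemes of finite type (in Borger's sense) are cyclotomic, their Frobenius lifts are restrictions of `z ↦ z^p` (Borger–de Smit 2008; Borger 2009)

Barrier catalogue `Literature/Barriers/RiemannHypothesis/` (D-0021), entry
`IntegralLambdaRingsCyclotomic` (namespace `Literature.Barriers.RiemannHypothesis`; catalogued
declaration `BorgerDeSmit2008_integralLambdaRingsCyclotomic : Prop`, a NAMED FACT — the one new
`def … : Prop` of this file (D-0014/D-0026); everything else is a definition with body or a proved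
theorem: the technique class `LambdaStructure` / `IsLambdaHom`, the model object `ℤ[μ_r]` with
`ψ_p(z) = z^p` PROVED to be a Λ-ring (`CyclotomicLambdaRing.lambdaStructure`), and the trace
mechanism `trace_transportMatrix` / `trace_funLeft`).  Companion of `AbsoluteZetaPolynomialCounting`
(the counting-polynomial side of the same `𝔽₁` literature).

## The technique (`𝔽₁`-geometry as Λ-structures; Borger 2009, Borger–de Smit 2008)

Borger [Borger2009LambdaF1, Introduction pp. 2–3]: the purpose of the "field with one element" is
"to prove the Riemann hypothesis … we might hope that `Spec ℤ` would be a kind of curve over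
`Spec 𝔽₁`, that `Spec ℤ ⊗_{𝔽₁} ℤ` would … be a surface bearing some kind of intersection theory,
and that we could then mimic over `ℤ` Weil's proof"; his proposal for "descent data to `𝔽₁`" on a
ring or scheme over `ℤ` is a **Λ-structure** = a commuting family of Frobenius lifts `ψ_p`.  For
rings whose additive group is torsion free this is [BorgerDeSmit2008, Introduction p. 1]:
"commuting ring endomorphisms `ψ_p : R → R`, one for each prime `p`, lifting the Frobenius map
modulo `p` — that is, such that `ψ_p(x) − x^p ∈ pR` for all `x ∈ R`. (The equivalence of this with
Grothendieck's original definition is proved in Wilkerson.)  An example that will be important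
here is `ℤ[μ_r] = ℤ[z]/(z^r − 1)`, where … `ψ_p` sends `z` to `z^p`.  A morphism of torsion-free
Λ-rings is the same as a ring map `f` that satisfies `f ∘ ψ_p = ψ_p ∘ f` for all primes `p`."
Typed here as `LambdaStructure A` (fields `psi`, `comm`, `lift`) and `IsLambdaHom`; the model
object `CyclotomicLambdaRing r := AdjoinRoot (X^r − 1 : ℤ[X])` with `psi r n : z ↦ z^n` is PROVED to
satisfy the axioms (`CyclotomicLambdaRing.psi_comm`, `CyclotomicLambdaRing.psi_frobenius` — the
congruence `g(z^p) ≡ g(z)^p (mod p)` via `𝔽_p[X]`), and `ψ_n(z^a) = z^{na mod r}`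
(`CyclotomicLambdaRing.psi_z_pow`): in the monomial basis `ψ_n` is the TRANSPORT MATRIX of
`a ↦ na` on `ℤ/rℤ` (Connes–Consani–Marcolli's `σ_n e(x) = e(nx)`, [ConnesConsaniMarcolli2009,
Prop. 2.1]), whose trace is the number of fixed points (`trace_transportMatrix`, PROVED for any
self-map of a finite set; pull-back form `trace_funLeft`); concretely, the trace of the `ℤ`-linear
map `ψ_n` on `ℤ[μ_r] ≅ ℤ^r` (power basis) is `#{a < r : na ≡ a (mod r)}`
(`CyclotomicLambdaRing.trace_psi`, PROVED, §5); it equals `gcd(r, n − 1)`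
(`CyclotomicLambdaRing.trace_psi_eq_gcd`, §6, reusing the Bost–Connes level-`r` count
`Literature.NumberTheory.BostConnes.card_fixedPoints_mul_eq_gcd`), and for `n = q = #𝔽` a finite
field it is the NUMBER OF `𝔽_q`-POINTS of the zero-dimensional `𝔽₁`-scheme `μ_r`,
`#Hom(ℤ[μ_r], 𝔽_q) = #{x ∈ 𝔽_q : x^r = 1} = gcd(r, q − 1)` (`CyclotomicLambdaRing.pointsEquiv`,
`card_rootsOfUnity_eq_gcd`, `trace_psi_eq_card_points`, PROVED, §6) — Connes–Consani–Marcolli's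
"`σ_{p^ℓ}` coincides with the Frobenius morphism" of `μ^{(m)}` [ConnesConsaniMarcolli2009, Prop. 5.1,
Remark 5.2, Thm. 6.2 (b)] read as a Lefschetz fixed-point formula.  §7 records Deitmar's form of the
counting condition for this object [Deitmar2006ZetaKTheoryF1, Thm. 1, Lemma 3]: `#μ_r(𝔽_q) = 1`
whenever `(q − 1, r) = 1` (zeta-polynomial `N = 1`, exponent `e = r`; `card_points_of_coprime`),
`= r` whenever `r ∣ q − 1` (`card_points_of_dvd`), so that for `r ≥ 2` NO polynomial interpolates
the count at all prime powers (`not_exists_countingPolynomial`, PROVED via Deitmar's Lemma 3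
mechanism `exists_coprime_two_pow_sub_one`): `μ_r` is one of the "simple examples" violating
Soulé's condition, outside the hypothesis of `AbsoluteZetaPolynomialCounting`.

## The obstruction (Borger–de Smit 2008, Thm. 1 and Cor. 3; Borger 2009, Thm. 1), a NAMED FACT

[BorgerDeSmit2008, Thm. 1 p. 2]: a Λ-ring `K` finite étale over `ℚ` "has an integral Λ-model if and
only if the action of `G_ℚ × ℕ^{>0}` on `S = Hom(K, ℚ̄)` factors (necessarily uniquely) through
`Ẑ°`" (profinite integers under multiplication, via the cyclotomic character and the inclusion);
"It follows that the category of such Λ-rings is anti-equivalent to the category of finite discrete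
sets with a continuous action of `Ẑ°` and that every such Λ-ring is contained in a product of
cyclotomic fields"; "Therefore `K` cannot be a field unless `K = ℚ`."  **Corollary 3** (p. 2–3):
"Every Λ-ring that has finite rank as an abelian group and has no non-zero nilpotent elements is a
sub-Λ-ring of a Λ-ring of the form `ℤ[μ_r]ⁿ`."  Proof ingredients (§2): "a simple application of the
Kronecker–Weber theorem and the Chebotarev density theorem with some elementary but slightly
intricate work on actions of the monoid `Ẑ°`" — neither is in Mathlib, so Cor. 3 is vendored as the
named fact `BorgerDeSmit2008_integralLambdaRingsCyclotomic` (for torsion-free `A`, finitely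
generated as a `ℤ`-module, reduced, with a `LambdaStructure`: an injective Λ-morphism into
`ℤ[μ_r]ⁿ` with its componentwise structure `piCyclotomicLambdaStructure`); its model case `A = ℤ[μ_r]`
is PROVED (`cyclotomicLambdaRing_embeds`).  The positive-dimensional form is [Borger2009LambdaF1,
Thm. 1 p. 3]: a smooth proper scheme over `ℤ[1/M]` that descends to `𝔽₁` (admits a Λ-structure) has
abelian Galois action on every `H^n_ét(X_ℚ̄, ℚ_p)`, which over some `ℚ(ζ_N)` is a sum of powers of the
cyclotomic character, and Hodge numbers `h^{i,j} = 0` for `i ≠ j` — "only abelian Artin–Tate motives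
can be defined over `𝔽₁` … this means there are no motivically interesting `𝔽₁`-schemes of finite
type"; Cor. 3 there: `#X(𝔽_q) = P(q)` (Hodge polynomial) for `q ≡ 1 (mod N)`, i.e. such `X` have a
polynomial counting function and fall under `AbsoluteZetaPolynomialCounting`.  That statement needs
étale cohomology / Hodge numbers / the scheme-theoretic Frobenius and `p`-adic Hodge theory (Kisin)
and is recorded in this docstring only (see `scope_caveats`).

## References

* [BorgerDeSmit2008] J. Borger, B. de Smit, *Galois theory and integral models of Λ-rings*, Bull.
  London Math. Soc. 40 (2008) 439–446 = arXiv:0801.2352 (read in the arXiv text: Introduction with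
  the definition, Thm. 1, Thm. 2, Cor. 3 and the remarks after it; §1 Props. 4–6; §2 (structure of
  the proof: Kronecker–Weber, Chebotarev); §3 Thm. 12).
* [Borger2009LambdaF1] J. Borger, *Λ-rings and the field with one element*, arXiv:0906.3146 (read:
  Introduction pp. 2–4 incl. Thm. 1, Thm. 2, Cor. 3 and the paragraphs quoted above).
* [ConnesConsaniMarcolli2009] A. Connes, C. Consani, M. Marcolli, *Fun with `𝔽₁`*, J. Number Theory
  129 (2009) = arXiv:0806.2401, Prop. 2.1 (`σ_n(e(x)) = e(nx)` on `ℤ[ℚ/ℤ]`; the same endomorphisms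
  on the level-`r` piece `ℤ[ℤ/rℤ] = ℤ[μ_r]`); §5 Prop. 5.1 and Remark 5.2 (`(σ_{p^ℓ} ⊗ σ_{𝔽_p}^ℓ)(f) =
  f^{p^ℓ}`: "at the fixed level `μ^{(m)} = Spec(A_m)`, the definition of `σ_{p^ℓ}` coincides with the
  Frobenius morphism"); §6.2 Thm. 6.2 (a) `ℤ[T]/(T^n − 1) ≅ A_n`, (b) (read in the arXiv text,
  pp. 15 and 19).
* [Deitmar2006ZetaKTheoryF1] A. Deitmar, *Remarks on zeta functions and `K`-theory over `𝔽₁`*,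
  Proc. Japan Acad. Ser. A 82 (2006) 141–146: Introduction (Soulé's condition; "Simple examples show
  that this is not the case"), Thm. 1 (`(q − 1, e) = 1 ⇒ #X(𝔽_q) = N(q)`), §2 Lemma 3 and the proof of
  Thm. 1 (`X(spec D_k) = Hom(A, D_k)`, `#Hom(S_𝔭, C_{k−1}) = (k−1)^r` when `(e, k−1) = 1`), Remark 1
  (`X(𝔽_q) ≅ X_ℤ(𝔽_q)`) (read at pp. 141–143).
* [ConnesConsani2010SchemesF1] A. Connes, C. Consani, *Schemes over `𝔽₁` and zeta functions*,
  Compos. Math. 146 (2010) = arXiv:0903.2024: Def. 4.9 (torsion free), Thm. 4.10 (1)–(2) and its proof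
  (`X_x(H) = Hom(𝒪_x^×, H)`, `H = ℤ/nℤ`, `n = q − 1`) (read in the arXiv text, p. 17).
* [IrelandRosen1990] K. Ireland, M. Rosen, *A Classical Introduction to Modern Number Theory*,
  GTM 84: Ch. 3 §3 Prop. 3.3.1 (solutions of `ax ≡ b (m)`), Ch. 4 §1 (`𝔽_q^×` cyclic) — via the
  tree's `Literature.NumberTheory.BostConnes.card_fixedPoints_mul_eq_gcd` and Mathlib's
  `IsCyclic.card_powMonoidHom_ker`.

## Design notes

* `LambdaStructure.psi : ℕ → A →+* A` is indexed by all naturals for convenience; only prime indices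
  carry axioms (as printed: "one for each prime `p`").  For `ℤ[μ_r]` the family `ψ_n : z ↦ z^n` is
  defined for every `n` and `ψ_m ψ_n = ψ_{mn}` (`psi_psi`).
* Cor. 3 is printed for Λ-rings "of finite rank as an abelian group" without nilpotents, torsion
  freeness being automatic by Segal's lemma for genuine λ-rings; with the naive (Frobenius-lift)
  definition used here torsion freeness must be ASSUMED (the authors warn that the naive definition
  "is not the correct definition in the absence of this assumption"), and "finite rank" is typed as
  `Module.Finite ℤ A` (a sub-ring of `ℤ[μ_r]ⁿ` is finitely generated anyway) — so the typed fact is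
  implied by the printed one.
* `transportMatrix R f i j = if f j = i then 1 else 0` (column `j` = `e_{f j}`); for a non-injective
  `f` (e.g. `a ↦ pa` on `ℤ/rℤ` with `p ∣ r`) it is not a permutation matrix, but its trace is still
  the number of fixed points — a natural number: the form in which Frobenius lifts of
  zero-dimensional Λ-rings enter Lefschetz-type trace formulas.
-/

noncomputable section

open Polynomial Finset Matrix

namespace Literature.Barriers.RiemannHypothesis

/-! ## §1. Λ-structures on torsion-free rings (Borger–de Smit's working definition) -/

/-- **A Λ-structure on a (torsion-free) commutative ring** in the form used by Borger–de Smit: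
"giving a Λ-action on such a ring `R` is the same as giving commuting ring endomorphisms
`ψ_p : R → R`, one for each prime `p`, lifting the Frobenius map modulo `p` — that is, such that
`ψ_p(x) − x^p ∈ pR` for all `x ∈ R`" (equivalent to Grothendieck's λ-ring axioms for torsion-free
`R` by Wilkerson's theorem).  The family is indexed by all naturals; only prime indices are
constrained. [cite: BorgerDeSmit2008, Introduction p. 1 (definition of Λ-action on torsion-free rings)] -/
structure LambdaStructure (A : Type*) [CommRing A] where
  /-- the Frobenius lifts `ψ_p` (values at non-prime indices are irrelevant) -/
  psi : ℕ → A →+* A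
  /-- the `ψ_p` commute pairwise -/
  comm : ∀ {p q : ℕ}, p.Prime → q.Prime → ∀ x : A, psi p (psi q x) = psi q (psi p x)
  /-- `ψ_p` lifts the Frobenius: `ψ_p(x) ≡ x^p (mod pA)` -/
  lift : ∀ {p : ℕ}, p.Prime → ∀ x : A, (p : A) ∣ psi p x - x ^ p

/-- A **morphism of torsion-free Λ-rings** "is the same as a ring map `f` that satisfies
`f ∘ ψ_p = ψ_p ∘ f` for all primes `p`". [cite: BorgerDeSmit2008, Introduction p. 1] -/
def IsLambdaHom {A B : Type*} [CommRing A] [CommRing B] (ΛA : LambdaStructure A)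
    (ΛB : LambdaStructure B) (f : A →+* B) : Prop :=
  ∀ {p : ℕ}, p.Prime → ∀ x : A, f (ΛA.psi p x) = ΛB.psi p (f x)

/-! ## §2. The example `ℤ[μ_r] = ℤ[z]/(z^r − 1)`, `ψ_p(z) = z^p` (PROVED to be a Λ-ring) -/

/-- `ℤ[μ_r] := ℤ[z]/(z^r − 1)` ("An example that will be important here is `ℤ[μ_r] = ℤ[z]/(z^r−1)`,
where `r` is a positive integer and `ψ_p` sends `z` to `z^p`"). [cite: BorgerDeSmit2008, Introduction p. 1] -/
abbrev CyclotomicLambdaRing (r : ℕ) : Type :=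
  AdjoinRoot (X ^ r - 1 : ℤ[X])

namespace CyclotomicLambdaRing

variable {r : ℕ}

/-- The generator `z` of `ℤ[μ_r]`. [cite: BorgerDeSmit2008, Introduction p. 1] -/
def z (r : ℕ) : CyclotomicLambdaRing r :=
  AdjoinRoot.root _

/-- `z^r = 1` in `ℤ[μ_r]`. [cite: BorgerDeSmit2008, Introduction p. 1] -/
theorem z_pow_self (r : ℕ) : z r ^ r = 1 := by
  have h := AdjoinRoot.eval₂_root (X ^ r - 1 : ℤ[X])
  simp only [eval₂_sub, eval₂_X_pow, eval₂_one] at h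
  exact sub_eq_zero.mp h

/-- `z^m` depends only on `m mod r` (as `z^r = 1` in `ℤ[μ_r] = ℤ[z]/(z^r − 1)`). [cite: BorgerDeSmit2008, Introduction p. 1] -/
theorem z_pow_eq_pow_mod (r m : ℕ) : z r ^ m = z r ^ (m % r) := by
  conv_lhs => rw [← Nat.mod_add_div m r, pow_add, pow_mul, z_pow_self, one_pow, mul_one]

/-- `z^n` is again a root of `X^r − 1`. [folklore] -/
private theorem eval₂_root_pow (r n : ℕ) :
    (X ^ r - 1 : ℤ[X]).eval₂ (AdjoinRoot.of (X ^ r - 1 : ℤ[X])) (z r ^ n) = 0 := by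
  simp only [eval₂_sub, eval₂_X_pow, eval₂_one, ← pow_mul]
  rw [mul_comm, pow_mul, z_pow_self, one_pow, sub_self]

/-- The endomorphism `ψ_n : z ↦ z^n` of `ℤ[μ_r]`. [cite: BorgerDeSmit2008, Introduction p. 1] -/
def psi (r n : ℕ) : CyclotomicLambdaRing r →+* CyclotomicLambdaRing r :=
  AdjoinRoot.lift (AdjoinRoot.of _) (z r ^ n) (eval₂_root_pow r n)

/-- `ψ_n(z) = z^n`. [cite: BorgerDeSmit2008, Introduction p. 1] -/
theorem psi_z (r n : ℕ) : psi r n (z r) = z r ^ n := by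
  simp only [z, psi, AdjoinRoot.lift_root]

/-- On the class of a polynomial `g(z)`, `ψ_n` is `g(z) ↦ g(z^n)`, i.e. `mk g ↦ mk (expand n g)`
("`ψ_p` sends `z` to `z^p`"). [cite: BorgerDeSmit2008, Introduction p. 1] -/
theorem psi_mk (r n : ℕ) (g : ℤ[X]) :
    psi r n (AdjoinRoot.mk _ g) = AdjoinRoot.mk _ (expand ℤ n g) := by
  rw [psi, AdjoinRoot.lift_mk, ← AdjoinRoot.algebraMap_eq, ← aeval_def, ← expand_aeval, z,
    AdjoinRoot.aeval_eq]

/-- `ψ_m ∘ ψ_n = ψ_{mn}` on `ℤ[μ_r]` (so the `ψ_p` generate an action of the multiplicative monoid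
`ℕ^{>0}`, "freely generated as a commutative monoid by the prime numbers"). [cite: BorgerDeSmit2008, Introduction p. 2] -/
theorem psi_psi (r m n : ℕ) (a : CyclotomicLambdaRing r) : psi r m (psi r n a) = psi r (m * n) a := by
  induction a using AdjoinRoot.induction_on with
  | ih g => rw [psi_mk, psi_mk, psi_mk, expand_expand]

/-- The `ψ_n` commute. [cite: BorgerDeSmit2008, Introduction p. 1] -/
theorem psi_comm (r m n : ℕ) (a : CyclotomicLambdaRing r) :
    psi r m (psi r n a) = psi r n (psi r m a) := by
  rw [psi_psi, psi_psi, mul_comm]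

/-- In `𝔽_p[X]`, `g(X^p) = g(X)^p`. [folklore] -/
private theorem expand_zmod_eq_pow {p : ℕ} (hp : p.Prime) (g : (ZMod p)[X]) :
    expand (ZMod p) p g = g ^ p := by
  haveI := Fact.mk hp
  have h := map_frobenius_expand (p := p) g
  rwa [ZMod.frobenius_zmod, Polynomial.map_id] at h

/-- In `ℤ[X]`, `p` divides `g(X^p) − g(X)^p` coefficientwise. [folklore] -/
private theorem C_dvd_expand_sub_pow {p : ℕ} (hp : p.Prime) (g : ℤ[X]) :
    (C (p : ℤ)) ∣ expand ℤ p g - g ^ p := by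
  rw [C_dvd_iff_dvd_coeff]
  intro i
  rw [← ZMod.intCast_zmod_eq_zero_iff_dvd]
  have h : (expand ℤ p g - g ^ p).map (Int.castRingHom (ZMod p)) = 0 := by
    rw [Polynomial.map_sub, Polynomial.map_pow, map_expand, expand_zmod_eq_pow hp, sub_self]
  have := congrArg (fun q => q.coeff i) h
  simpa only [coeff_map, eq_intCast, coeff_zero] using this

/-- **`ψ_p` lifts the Frobenius on `ℤ[μ_r]`**: `ψ_p(a) − a^p ∈ p ℤ[μ_r]`. [cite: BorgerDeSmit2008, Introduction p. 1] -/
theorem psi_frobenius (r : ℕ) {p : ℕ} (hp : p.Prime) (a : CyclotomicLambdaRing r) :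
    (p : CyclotomicLambdaRing r) ∣ psi r p a - a ^ p := by
  induction a using AdjoinRoot.induction_on with
  | ih g =>
    obtain ⟨h, hh⟩ := C_dvd_expand_sub_pow hp g
    refine ⟨AdjoinRoot.mk _ h, ?_⟩
    rw [psi_mk, ← map_pow, ← map_sub, hh, map_mul, AdjoinRoot.mk_C, map_natCast]

/-- **`ℤ[μ_r]` with `ψ_p(z) = z^p` is a Λ-ring** (the basic example; the sufficiency half of
Borger–de Smit's Theorem 1 is built from it). [cite: BorgerDeSmit2008, Introduction p. 1 and §1] -/
def lambdaStructure (r : ℕ) : LambdaStructure (CyclotomicLambdaRing r) where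
  psi := psi r
  comm := fun _ _ a => psi_comm r _ _ a
  lift := fun hp a => psi_frobenius r hp a

/-- `ψ_n(z^a) = z^{na}`: on the monomial basis `ψ_n` TRANSPORTS basis vectors along `a ↦ na (mod r)`
(Connes–Consani–Marcolli's `σ_n e(x) = e(nx)` on the group ring of `ℤ/rℤ`). [cite: BorgerDeSmit2008, Introduction p. 1]
[cite: ConnesConsaniMarcolli2009, Prop. 2.1] -/
theorem psi_z_pow (r n a : ℕ) : psi r n (z r ^ a) = z r ^ (n * a % r) := by
  rw [map_pow, psi_z, ← pow_mul, z_pow_eq_pow_mod]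

end CyclotomicLambdaRing

/-- The product Λ-structure on `ℤ[μ_r]ⁿ` (componentwise `ψ_p`). [cite: BorgerDeSmit2008, Cor. 3 and §1 ("limits … agree, as rings, with those taken in the category of rings")] -/
def piCyclotomicLambdaStructure (r n : ℕ) : LambdaStructure (Fin n → CyclotomicLambdaRing r) where
  psi := fun m => (CyclotomicLambdaRing.psi r m).compLeft (Fin n)
  comm := fun _ _ x => by
    funext i
    simp only [RingHom.compLeft_apply, Function.comp_apply, CyclotomicLambdaRing.psi_comm]
  lift := fun hp x => by
    choose c hc using fun i => CyclotomicLambdaRing.psi_frobenius r hp (x i)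
    refine ⟨c, ?_⟩
    funext i
    simp only [Pi.sub_apply, Pi.pow_apply, Pi.mul_apply, Pi.natCast_apply, RingHom.compLeft_apply,
      Function.comp_apply]
    exact hc i

/-! ## §3. Transport matrices: the Lefschetz trace of a map transporting a basis along a self-map of a finite set is the number of fixed points (PROVED) -/

section Transport

variable {S : Type*} [Fintype S] [DecidableEq S] (R : Type*) [CommRing R]

/-- The **transport matrix** of a self-map `f` of a finite set: column `j` is the basis vector
`e_{f j}` (`e_j ↦ e_{f(j)}`, as `ψ_n : z^a ↦ z^{na}` on `ℤ[μ_r]`, `σ_n e(x) = e(nx)`); for a bijection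
it is the permutation matrix of the permutation representation. [cite: ConnesConsaniMarcolli2009, Prop. 2.1]
[cite: FultonHarris1991, §2.1 Exercise 2.5 ("the original fixed-point formula")] -/
def transportMatrix (f : S → S) : Matrix S S R :=
  fun i j => if f j = i then 1 else 0

/-- The transport matrix sends `e_j` to `e_{f j}` (`σ_n e(x) = e(nx)`). [cite: ConnesConsaniMarcolli2009, Prop. 2.1] -/
theorem transportMatrix_mulVec_single (f : S → S) (j : S) :
    (transportMatrix R f).mulVec (Pi.single j 1) = Pi.single (f j) 1 := by
  ext i
  simp only [transportMatrix, mulVec, dotProduct, Pi.single_apply, mul_ite, mul_one, mul_zero,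
    Finset.sum_ite_eq', Finset.mem_univ, if_true]
  exact if_congr eq_comm rfl rfl

/-- **Trace of a transport matrix = number of fixed points** — a non-negative integer: the
mechanism by which every Frobenius lift of a zero-dimensional Λ-ring of finite type has
natural-number Lefschetz traces (`#{a ∈ ℤ/r : na = a}` for `ψ_n` on `ℤ[μ_r]`); for a group action
this is "the original fixed-point formula" `χ_V(g) = #X^g`, and the same diagonal count works for any
self-map. [cite: FultonHarris1991, §2.1 Exercise 2.5] -/
theorem trace_transportMatrix (f : S → S) :
    (transportMatrix R f).trace = ((univ.filter fun s => f s = s).card : R) := by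
  simp only [Matrix.trace, Matrix.diag, transportMatrix]
  rw [Finset.sum_ite, Finset.sum_const_zero, add_zero, Finset.sum_const, nsmul_eq_mul, mul_one]

/-- The PULLBACK form (functions on a finite `Ẑ°`-set `S`, `g ↦ g ∘ f` — Borger–de Smit's
description of a finite étale `ℚ`-Λ-algebra as functions on `S = Hom(K, ℚ̄)`): its trace is again the
number of fixed points of `f`. [cite: BorgerDeSmit2008, Introduction (Λ-rings finite étale over ℚ = finite `G_ℚ × ℕ`-sets) and Thm. 1] -/
theorem trace_funLeft (f : S → S) :
    LinearMap.trace R (S → R) (LinearMap.funLeft R R f) = ((univ.filter fun s => f s = s).card : R) := by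
  rw [LinearMap.trace_eq_matrix_trace R (Pi.basisFun R S)]
  have hM : LinearMap.toMatrix (Pi.basisFun R S) (Pi.basisFun R S) (LinearMap.funLeft R R f) =
      fun i j => if f i = j then 1 else 0 := by
    ext i j
    rw [LinearMap.toMatrix_apply, Pi.basisFun_repr, LinearMap.funLeft_apply, Pi.basisFun_apply,
      Pi.single_apply]
  rw [hM]
  simp only [Matrix.trace, Matrix.diag]
  rw [Finset.sum_ite, Finset.sum_const_zero, add_zero, Finset.sum_const, nsmul_eq_mul, mul_one]

end Transport

/-! ## §4. The catalogued barrier (named fact: Borger–de Smit's Corollary 3) -/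

/-- **Barrier (Borger–de Smit 2008, Cor. 3): every reduced torsion-free Λ-ring of finite rank is
a sub-Λ-ring of `ℤ[μ_r]ⁿ`** — the zero-dimensional `𝔽₁`-schemes of finite type in Borger's sense are
cyclotomic; NAMED FACT (proof = Kronecker–Weber + Chebotarev + `Ẑ°`-combinatorics, not in Mathlib).
Typed: for a commutative ring `A`, reduced, torsion free and finitely generated as a `ℤ`-module,
with a `LambdaStructure Λ`, there are `r ≥ 1`, `n` and an INJECTIVE ring map `ι : A → ℤ[μ_r]ⁿ`
with `ι ∘ ψ_p = ψ_p ∘ ι` for all primes `p` (`IsLambdaHom Λ (piCyclotomicLambdaStructure r n) ι`).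

BARRIER (structured block, D-0021):
- technique_class: F1-geometry Lambda-rings Lambda-schemes Frobenius-lifts Borger-descent-to-F1 zero-dimensional finite-flat-Lambda-rings Witt/cyclotomic; formally `LambdaStructure A` (commuting ring endomorphisms `ψ_p` with `ψ_p(x) − x^p ∈ pA`) on `A` with `[IsReduced A] [Module.Finite ℤ A] [NoZeroSMulDivisors ℤ A]`, morphisms `IsLambdaHom` [cite: BorgerDeSmit2008, Introduction p. 1] [cite: Borger2009LambdaF1, Introduction pp. 2–3 (Λ-structures as descent data to 𝔽₁)]
- blocks: "strong arithmetic restrictions on the complexity of finitely generated rings that admit a Λ-ring structure" in the zero-dimensional case: no such Λ-ring is a field other than `ℚ ⊗ ℤ = ℚ`, all are sub-Λ-rings of `ℤ[μ_r]ⁿ` (finite `Ẑ°`-sets), so their Frobenius lifts `ψ_p` are restrictions of `z ↦ z^p` — transport maps of `a ↦ pa` on `ℤ/rℤ` with natural-number Lefschetz traces (`psi_z_pow`, `trace_transportMatrix`) [cite: BorgerDeSmit2008, Thm. 1, Cor. 3, and "Therefore K cannot be a field unless K = ℚ"]; in positive dimension (recorded, not typed): Λ-schemes smooth proper over `ℤ[1/M]`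 carry only abelian Artin–Tate cohomology, `h^{i,j} = 0` for `i ≠ j`, `#X(𝔽_q) =` Hodge polynomial — "there are no motivically interesting 𝔽₁-schemes of finite type", in particular no `H¹`-type (odd-weight) cohomology on which zeta zeros could appear, for the programme "Spec ℤ a curve over Spec 𝔽₁ … mimic Weil's proof" restricted to schemes of finite type [cite: Borger2009LambdaF1, Introduction p. 2 (RH motivation), Thm. 1, Cor. 3, and "only abelian Artin–Tate motives can be defined over 𝔽₁"]
- because: the commuting Frobenius lifts force the `G_ℚ × ℕ^{>0}`-action on `S = Hom(K, ℚ̄)` to factor through the monoid `Ẑ°` via the cyclotomic character (Chebotarev: `ψ_p` IS the Frobenius at almost all `p`; then Kronecker–Weber), which makes `K = ℚ ⊗ A` a finite `Ẑ°`-set algebra inside a product of cyclotomic fields, with maximal integral model `ℤ[μ_r]` at level `r` [cite: BorgerDeSmit2008, Thm. 1, §2 ("Kronecker–Weber theorem and the Chebotarev density theorem"), Thm. 2]; in positive dimension additionally proper base change, Lefschetz and `p`-adic Hodge theory (Kisin) [cite: Borger2009LambdaF1, Introduction p. 3 (paragraph after Thm. 1)]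
- evasions_known: leave finite type — "the spaces of principal interest over 𝔽₁ are not those of finite type": the big Witt vectors `W = Λ_!` and arithmetic jet spaces `Λ_*` of schemes over `ℤ` are Λ-spaces almost never of finite type, and "I expect that the cohomological theory of infinite-dimensional spaces over 𝔽₁ contains, via Λ_! and de Rham–Witt theory, the full theory of motives" [cite: Borger2009LambdaF1, Introduction pp. 3–4]; over general number fields, Frobenius lifts modulo prime ideals bring in class field theory and complex multiplication [cite: BorgerDeSmit2008, Introduction (last paragraph)]
- status: established (Bull. LMS 2008, refereed; Borger 2009 is an arXiv preprint whose Thm. 1 relies on published `p`-adic Hodge theory — its positive-dimensional statement is quoted here, not typed)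
- scope_caveats: (i) only the ZERO-DIMENSIONAL statement (Cor. 3) is typed, and only its containment clause — the `Ẑ°`-set anti-equivalence of Thm. 1, the maximality of `ℤ[μ_r]` (Thm. 2) and Borger's positive-dimensional Thm. 1 / Cor. 3 are in the docstring only (étale cohomology, Hodge numbers and the scheme-theoretic Frobenius congruence are not available in Mathlib) [cite: BorgerDeSmit2008, Thm. 1, Thm. 2] [cite: Borger2009LambdaF1, Thm. 1]; (ii) Λ-rings are taken in the naive Frobenius-lift form, correct only for torsion-free rings, hence the explicit torsion-freeness hypothesis; "finite rank" is typed as finitely generated [cite: BorgerDeSmit2008, Introduction (remarks after Cor. 3)]; (iii) nothing is said about `𝔽₁`-geometries NOT based on Λ-structures (Deitmar/Connes–Consani monoid schemes, Tits–Weyl models, Lorscheid blueprints, Haran, Durov), about Λ-spaces of infinite type (Witt vectors, Bost–Connes/arithmetic-site objects with their `ℕ^×`-actions), nor about the counting-polynomial zeta itself (that is `AbsoluteZetaPolynomialCounting`) [cite: Borger2009LambdaF1, Introduction p. 2 (monoid approach vs Λ approach)].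

[cite: BorgerDeSmit2008, Cor. 3 (with Thm. 1)] -/
def BorgerDeSmit2008_integralLambdaRingsCyclotomic : Prop :=
  ∀ (A : Type) [CommRing A] [IsReduced A] [Module.Finite ℤ A] [NoZeroSMulDivisors ℤ A]
    (Λ : LambdaStructure A),
    ∃ (r n : ℕ) (ι : A →+* (Fin n → CyclotomicLambdaRing r)),
      0 < r ∧ Function.Injective ι ∧ IsLambdaHom Λ (piCyclotomicLambdaStructure r n) ι

/-- The model case of the barrier, PROVED: `ℤ[μ_r]` itself (with `n = 1`, `ι` the diagonal). [cite: BorgerDeSmit2008, Thm. 2 (`ℤ[μ_r]` is the maximal integral Λ-model of `ℚ ⊗ ℤ[μ_r]`)] -/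
theorem cyclotomicLambdaRing_embeds (r : ℕ) :
    ∃ (n : ℕ) (ι : CyclotomicLambdaRing r →+* (Fin n → CyclotomicLambdaRing r)),
      Function.Injective ι ∧
        IsLambdaHom (CyclotomicLambdaRing.lambdaStructure r) (piCyclotomicLambdaStructure r n) ι := by
  refine ⟨1, Pi.constRingHom (Fin 1) (CyclotomicLambdaRing r), Function.const_injective, fun _ x => ?_⟩
  funext i
  simp only [piCyclotomicLambdaStructure, CyclotomicLambdaRing.lambdaStructure, Pi.constRingHom_apply,
    RingHom.compLeft_apply, Function.comp_apply, Function.const_apply]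


/-! ## §5. The Lefschetz trace of `ψ_n` on `ℤ[μ_r]` is the number of fixed points of `a ↦ na` on `ℤ/rℤ` (PROVED) -/

namespace CyclotomicLambdaRing

/-- `X^r − 1 ∈ ℤ[X]` is monic (`r ≠ 0`). [folklore] -/
private theorem monic_X_pow_sub_one {r : ℕ} (hr : r ≠ 0) : (X ^ r - 1 : ℤ[X]).Monic := by
  simpa using monic_X_pow_sub_C (1 : ℤ) hr

/-- The power basis `1, z, …, z^{r−1}` of `ℤ[μ_r]` has `r` elements. [cite: BorgerDeSmit2008, Introduction p. 1 (`ℤ[μ_r] = ℤ[z]/(z^r − 1)`)] -/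
theorem powerBasis_dim {r : ℕ} (hr : r ≠ 0) :
    (AdjoinRoot.powerBasis' (monic_X_pow_sub_one hr)).dim = r := by
  rw [AdjoinRoot.powerBasis'_dim]
  simpa using natDegree_X_pow_sub_C (n := r) (r := (1 : ℤ))

/-- `ψ_n` on powers of the generator `root = z`. [cite: BorgerDeSmit2008, Introduction p. 1] -/
theorem psi_root_pow (r n a : ℕ) :
    psi r n (AdjoinRoot.root (X ^ r - 1 : ℤ[X]) ^ a) = z r ^ (n * a % r) :=
  psi_z_pow r n a

/-- Coordinates of `z^m` in the power basis: `z^m = z^{m mod r}` is the basis vector of index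
`m mod r`. [cite: BorgerDeSmit2008, Introduction p. 1] -/
theorem powerBasis_repr_z_pow {r : ℕ} (hr : r ≠ 0) (m : ℕ)
    (i : Fin (AdjoinRoot.powerBasis' (monic_X_pow_sub_one hr)).dim) :
    (AdjoinRoot.powerBasis' (monic_X_pow_sub_one hr)).basis.repr (z r ^ m) i =
      if (i : ℕ) = m % r then 1 else 0 := by
  have hk : m % r < (AdjoinRoot.powerBasis' (monic_X_pow_sub_one hr)).dim := by
    rw [powerBasis_dim hr]
    exact Nat.mod_lt _ (Nat.pos_of_ne_zero hr)
  have hz : z r ^ m = (AdjoinRoot.powerBasis' (monic_X_pow_sub_one hr)).basis ⟨m % r, hk⟩ := by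
    rw [z_pow_eq_pow_mod, PowerBasis.coe_basis]
    rfl
  rw [hz, Module.Basis.repr_self, Finsupp.single_apply]
  exact if_congr ⟨fun h => by rw [← h], fun h => Fin.ext h.symm⟩ rfl rfl

/-- **Lefschetz trace of a Frobenius lift of `ℤ[μ_r]`**: the trace of the `ℤ`-linear map `ψ_n` on
`ℤ[μ_r] ≅ ℤ^r` equals the number of `a ∈ {0, …, r−1}` with `na ≡ a (mod r)` — a natural number (for
`n = p^k` prime to `r` this is `#μ_r(𝔽_{p^k}) = gcd(p^k − 1, r)`; "the map primes ↦ fixed points" is a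
theorem for this object). [cite: BorgerDeSmit2008, Introduction p. 1] [cite: ConnesConsaniMarcolli2009, Prop. 2.1]
[cite: FultonHarris1991, §2.1 Exercise 2.5] -/
theorem trace_psi {r : ℕ} (hr : r ≠ 0) (n : ℕ) :
    LinearMap.trace ℤ (CyclotomicLambdaRing r) (psi r n).toIntAlgHom.toLinearMap =
      (((range r).filter fun a => n * a % r = a).card : ℤ) := by
  rw [LinearMap.trace_eq_matrix_trace ℤ (AdjoinRoot.powerBasis' (monic_X_pow_sub_one hr)).basis]
  have hdiag : ∀ i : Fin (AdjoinRoot.powerBasis' (monic_X_pow_sub_one hr)).dim,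
      LinearMap.toMatrix (AdjoinRoot.powerBasis' (monic_X_pow_sub_one hr)).basis
        (AdjoinRoot.powerBasis' (monic_X_pow_sub_one hr)).basis
        (psi r n).toIntAlgHom.toLinearMap i i = if n * (i : ℕ) % r = (i : ℕ) then 1 else 0 := by
    intro i
    rw [LinearMap.toMatrix_apply, PowerBasis.coe_basis]
    simp only [AlgHom.toLinearMap_apply, RingHom.toIntAlgHom_apply, AdjoinRoot.powerBasis'_gen,
      psi_root_pow, powerBasis_repr_z_pow hr, Nat.mod_mod]
    exact if_congr eq_comm rfl rfl
  simp only [Matrix.trace, Matrix.diag, hdiag]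
  rw [Fin.sum_univ_eq_sum_range (fun a => if n * a % r = a then (1 : ℤ) else 0), powerBasis_dim hr,
    Finset.sum_boole, Nat.cast_inj]

end CyclotomicLambdaRing

/-! ## §6. Lefschetz trace of the Frobenius lift `ψ_q` on `ℤ[μ_r]` = number of `𝔽_q`-points of `μ_r` (PROVED)

Connes–Consani–Marcolli [ConnesConsaniMarcolli2009, Prop. 5.1, Remark 5.2, Thm. 6.2 (b)]: on
`A_m ⊗ K = K[ℤ/mℤ]` (`K` perfect of characteristic `p`) the endomorphism `σ_{p^ℓ}` satisfies
`(σ_{p^ℓ} ⊗ σ_{𝔽_p}^ℓ)(f) = f^{p^ℓ}`, i.e. "at the fixed level `μ^{(m)} = Spec(A_m)` the definition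
of `σ_{p^ℓ}` coincides with the Frobenius morphism" (geometric Frobenius).  Deitmar
[Deitmar2006ZetaKTheoryF1, §2 and Remark 1]: for an `𝔽₁`-scheme `X` of finite type,
`X(𝔽_q) = Hom(spec 𝔽_q, X) ≅ X_ℤ(𝔽_q)`, and for `X = spec A` this is `Hom(A, (𝔽_q, ×))`; for the
group `ℤ/rℤ` (the monoid of `μ_r = μ^{(r)}`, `A_r = ℤ[ℤ/rℤ] = ℤ[T]/(T^r − 1)`
[ConnesConsaniMarcolli2009, Thm. 6.2 (a)]) the `S`-points are the `r`-th roots of unity of `S`.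
Here: the points functor `Hom(ℤ[μ_r], S) ≃ {x ∈ S : x^r = 1}` (`pointsEquiv`), the count
`#μ_r(𝔽) = gcd(r, #𝔽 − 1)` for a finite field (`card_rootsOfUnity_eq_gcd`, from the cyclicity of
`𝔽ˣ`), the trace `Tr(ψ_n | ℤ[μ_r]) = gcd(r, n − 1)` (`trace_psi_eq_gcd`, REUSING
`Literature.NumberTheory.BostConnes.card_fixedPoints_mul_eq_gcd` for the level `A_r` of the
Bost–Connes endomotive), hence the fixed-point formula `Tr(ψ_{#𝔽} | ℤ[μ_r]) = #Hom(ℤ[μ_r], 𝔽)`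
(`trace_psi_eq_card_points`): for this zero-dimensional `𝔽₁`-object "the map primes ↦ fixed
points" is a theorem, with values in `ℕ`. -/

namespace CyclotomicLambdaRing

variable {r : ℕ}

/-- The fixed points of `a ↦ na` on `{0, …, r−1}` (residues) are those of `γ ↦ nγ` on `ℤ/rℤ`.
[folklore] -/
private theorem card_fixedPoints_range_eq_zmod (r : ℕ) [NeZero r] (n : ℕ) :
    ((range r).filter fun a => n * a % r = a).card =
      (univ.filter fun j : ZMod r => (n : ZMod r) * j = j).card := by
  refine Finset.card_bij (fun a _ => (a : ZMod r)) ?_ ?_ ?_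
  · intro a ha
    rw [mem_filter] at ha
    rw [mem_filter]
    refine ⟨mem_univ _, ?_⟩
    have h2 : ((n * a : ℕ) : ZMod r) = ((a : ℕ) : ZMod r) := by
      rw [ZMod.natCast_eq_natCast_iff', ha.2, Nat.mod_eq_of_lt (mem_range.mp ha.1)]
    simpa [Nat.cast_mul] using h2
  · intro a ha b hb hab
    have ha' := mem_range.mp (mem_filter.mp ha).1
    have hb' := mem_range.mp (mem_filter.mp hb).1
    have := (ZMod.natCast_eq_natCast_iff' a b r).mp hab
    rwa [Nat.mod_eq_of_lt ha', Nat.mod_eq_of_lt hb'] at this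
  · intro j hj
    refine ⟨j.val, ?_, ZMod.natCast_zmod_val j⟩
    rw [mem_filter] at hj ⊢
    refine ⟨mem_range.mpr (ZMod.val_lt j), ?_⟩
    have h2 : ((n * j.val : ℕ) : ZMod r) = ((j.val : ℕ) : ZMod r) := by
      rw [Nat.cast_mul, ZMod.natCast_zmod_val]; exact hj.2
    rw [ZMod.natCast_eq_natCast_iff', Nat.mod_eq_of_lt (ZMod.val_lt j)] at h2
    exact h2

/-- **`Tr(ψ_n | ℤ[μ_r]) = gcd(r, n − 1)`** (`r, n ≥ 1`): the Lefschetz trace of the Frobenius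
lift `ψ_n` of `ℤ[μ_r]` is the number of solutions of `(n − 1)γ ≡ 0 (mod r)` — the level-`r`
instance of the Bost–Connes endomotive trace `Tr(σ_k | A_n) = gcd(n, k − 1)`
(`Literature.NumberTheory.BostConnes.trace_sigmaMatrix`, same object
[ConnesConsaniMarcolli2009, Thm. 6.2 (a)]: `ℤ[T]/(T^n − 1) ≅ A_n`). [cite: ConnesConsaniMarcolli2009, Prop. 2.1 and Thm. 6.2 (a)]
[cite: IrelandRosen1990, Ch. 3 §3 Prop. 3.3.1 (number of solutions of a linear congruence)] -/
theorem trace_psi_eq_gcd (hr : r ≠ 0) {n : ℕ} (hn : 1 ≤ n) :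
    LinearMap.trace ℤ (CyclotomicLambdaRing r) (psi r n).toIntAlgHom.toLinearMap =
      (Nat.gcd r (n - 1) : ℤ) := by
  haveI : NeZero r := ⟨hr⟩
  rw [trace_psi hr, card_fixedPoints_range_eq_zmod r n,
    Literature.NumberTheory.BostConnes.card_fixedPoints_mul_eq_gcd hn]

/-- **The points functor of `μ_r = Spec ℤ[μ_r]`**: for every commutative ring `S`,
`Hom(ℤ[μ_r], S) ≃ μ_r(S) = {x ∈ S : x^r = 1}` (a ring map out of `ℤ[z]/(z^r − 1)` is the choice
of an `r`-th root of unity `φ(z)`; Deitmar: `X(spec D) = Hom(A, D)` for `X = spec A`, here with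
the group `ℤ/rℤ` as monoid, `Hom_{Mon}(ℤ/rℤ, (S, ×)) = {x : x^r = 1}`). [cite: Deitmar2006ZetaKTheoryF1, §2 (proof of Thm. 1: `X(spec(D_k)) = Hom(A, D_k)`, `Hom(S_𝔭, C_{k−1}) = Hom(Quot(S_𝔭), C_{k−1})`) and Remark 1]
[cite: ConnesConsaniMarcolli2009, Thm. 6.2 (a) (`ℤ[T]/(T^n − 1) ≅ A_n`, `μ^{(n)} = Spec(A_n)`)] -/
def pointsEquiv (r : ℕ) (S : Type*) [CommRing S] :
    (CyclotomicLambdaRing r →+* S) ≃ {x : S // x ^ r = 1} where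
  toFun φ := ⟨φ (z r), by rw [← map_pow, z_pow_self, map_one]⟩
  invFun x := AdjoinRoot.lift (Int.castRingHom S) x.1 (by
    simp only [eval₂_sub, eval₂_X_pow, eval₂_one, x.2, sub_self])
  left_inv φ := by
    dsimp only
    refine RingHom.ext fun a => ?_
    induction a using AdjoinRoot.induction_on with
    | ih g =>
      rw [AdjoinRoot.lift_mk, ← AdjoinRoot.aeval_eq, Polynomial.aeval_def, Polynomial.hom_eval₂,
        RingHom.ext_int (φ.comp (algebraMap ℤ _)) (Int.castRingHom S)]
      rfl
  right_inv x := by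
    ext
    simp only [z, AdjoinRoot.lift_root]

/-- `pointsEquiv` sends `φ` to `φ(z)`. [cite: Deitmar2006ZetaKTheoryF1, §2] -/
@[simp] theorem pointsEquiv_apply (S : Type*) [CommRing S] (φ : CyclotomicLambdaRing r →+* S) :
    ((pointsEquiv r S φ : {x : S // x ^ r = 1}) : S) = φ (z r) := rfl

/-- `#Hom(ℤ[μ_r], S) = #{x ∈ S : x^r = 1}` (as `Nat.card`, so also meaningful — both `0` — for
infinite point sets). [cite: Deitmar2006ZetaKTheoryF1, §2 and Remark 1] -/
theorem card_points_eq (r : ℕ) (S : Type*) [CommRing S] :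
    Nat.card (CyclotomicLambdaRing r →+* S) = Nat.card {x : S // x ^ r = 1} :=
  Nat.card_congr (pointsEquiv r S)

/-- **`#μ_r(𝔽) = gcd(r, #𝔽 − 1)` for a finite field `𝔽`** (`r ≥ 1`): the `r`-th roots of unity
in `𝔽` form the kernel of `x ↦ x^r` on the cyclic group `𝔽ˣ` of order `#𝔽 − 1`, which has
`gcd(#𝔽 − 1, r)` elements (Deitmar's count `#Hom(Quot(S_𝔭), C_{k−1})`, which is `(k−1)^{rank}`
exactly when the exponent is prime to `k − 1`). [cite: Deitmar2006ZetaKTheoryF1, §2 (proof of Thm. 1)]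
[cite: IrelandRosen1990, Ch. 4 §1 (𝔽ˣ_q cyclic) and Ch. 3 §3 Prop. 3.3.1] -/
theorem card_rootsOfUnity_eq_gcd (F : Type*) [Field F] [Finite F] (hr : r ≠ 0) :
    Nat.card {x : F // x ^ r = 1} = Nat.gcd r (Nat.card F - 1) := by
  haveI : NeZero r := ⟨hr⟩
  have h1 : Nat.card {x : F // x ^ r = 1} = Nat.card (rootsOfUnity r F) := by
    refine Nat.card_congr ((Equiv.subtypeEquivRight fun x => ?_).trans
      (rootsOfUnityEquivNthRoots F r).symm)
    rw [mem_nthRoots (Nat.pos_of_ne_zero hr)]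
  have h2 : rootsOfUnity r F = (powMonoidHom r : Fˣ →* Fˣ).ker := by
    ext ζ
    rw [mem_rootsOfUnity, MonoidHom.mem_ker, powMonoidHom_apply]
  rw [h1, h2, IsCyclic.card_powMonoidHom_ker, Nat.card_units, Nat.gcd_comm]

/-- **Fixed-point formula for `μ_r` over `𝔽₁`: the Lefschetz trace of the Frobenius lift `ψ_q`
on `ℤ[μ_r] ≅ ℤ^r` equals the number of `𝔽_q`-points `#Hom(ℤ[μ_r], 𝔽_q) = #μ_r(𝔽_q)`** (for every
finite field `𝔽`, `q = #𝔽`, `r ≥ 1`; both sides equal `gcd(r, q − 1)`).  This is the Weil-type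
reading of the census quantity "Str ψ_{p^k} = #μ_n(𝔽_{p^k})": Connes–Consani–Marcolli identify
`σ_{p^ℓ} = ψ_{p^ℓ}` with the geometric Frobenius of `μ^{(m)} ⊗ K` (Prop. 5.1: `(σ_{p^ℓ} ⊗ σ_{𝔽_p}^ℓ)(f)
= f^{p^ℓ}`; Remark 5.2; Thm. 6.2 (b)), and Deitmar identifies `X(𝔽_q)` with `X_ℤ(𝔽_q) = Hom(A, (𝔽_q, ×))`.
[cite: ConnesConsaniMarcolli2009, Prop. 5.1, Remark 5.2 and Thm. 6.2 (b)] [cite: Deitmar2006ZetaKTheoryF1, §2 and Remark 1 (`X(𝔽_q) ≅ X_ℤ(𝔽_q)`)] -/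
theorem trace_psi_eq_card_points (F : Type*) [Field F] [Finite F] (hr : r ≠ 0) :
    LinearMap.trace ℤ (CyclotomicLambdaRing r) (psi r (Nat.card F)).toIntAlgHom.toLinearMap =
      Nat.card (CyclotomicLambdaRing r →+* F) := by
  have hq : 1 ≤ Nat.card F := Nat.one_le_iff_ne_zero.mpr Nat.card_pos.ne'
  rw [trace_psi_eq_gcd hr hq, card_points_eq, card_rootsOfUnity_eq_gcd F hr]

/-! ## §7. Deitmar's Theorem 1 for `μ_r`, and the failure of Soulé's condition (PROVED)

[Deitmar2006ZetaKTheoryF1, Introduction and Thm. 1]: Soulé's condition asks for a polynomial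
`N(x) ∈ ℤ[x]` with `#X(𝔽_{p^n}) = N(p^n)` for all primes `p` and `n ∈ ℕ`; "The natural question
arising is whether schemes defined over `𝔽₁` satisfy Soulé's condition.  Simple examples show that
this is not the case.  However, schemes defined over `𝔽₁` satisfy a slightly weaker condition …
**Theorem 1.** Let `X` be a `ℤ`-scheme of finite type defined over `𝔽₁`.  Then there exists a
natural number `e` and a polynomial `N(x)` with integer coefficients such that for every prime
power `q` one has `(q − 1, e) = 1 ⇒ #X(𝔽_q) = N(q)`" (uniqueness via Lemma 3: "For every natural
number `e` there are infinitely many prime powers `q` with `(q−1, e) = 1`", proof with `q = 2ⁿ`,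
`e = 2^k m`).  For `X = μ_r`: `(e, N) = (r, 1)` (`card_points_of_coprime`), while on the
progression `r ∣ q − 1` (the `𝔽_{1^n}`-points of Connes–Consani, `n = q − 1`,
[ConnesConsani2010SchemesF1, Thm. 4.10 (1)–(2)], whose polynomiality needs the torsion-free
hypothesis) the count is `r` (`card_points_of_dvd`); consequently for `r ≥ 2` NO polynomial
interpolates `#μ_r(𝔽_q)` at all prime powers (`not_exists_countingPolynomial`: `μ_r` is one of the
"simple examples", and lies outside the hypothesis of `AbsoluteZetaPolynomialCounting`). -/

/-- Deitmar's Theorem 1 for `μ_r`, generic case: if `(q − 1, r) = 1` then `#μ_r(𝔽_q) = 1`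
(zeta-polynomial `N_{μ_r} = 1`, exponent `e = r`: "If `e` is coprime to `k − 1`, then there is no
non-trivial homomorphism from the torsion part of `Quot(S_𝔭)` to `C_{k−1}`").
[cite: Deitmar2006ZetaKTheoryF1, Thm. 1 and §2 (end of proof)] -/
theorem card_points_of_coprime (F : Type*) [Field F] [Finite F] (hr : r ≠ 0)
    (h : Nat.Coprime (Nat.card F - 1) r) :
    Nat.card (CyclotomicLambdaRing r →+* F) = 1 := by
  rw [card_points_eq, card_rootsOfUnity_eq_gcd F hr, Nat.gcd_comm]
  exact h

/-- The complementary progression: if `r ∣ q − 1` then `#μ_r(𝔽_q) = r` (all `r`-th roots of unity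
are rational; this is the `𝔽_{1^n}`-point count `#Hom(ℤ/rℤ, ℤ/nℤ) = r` of Connes–Consani at
`n = q − 1` when `r ∣ n`). [cite: ConnesConsani2010SchemesF1, Thm. 4.10 (1)–(2) and its proof (`X_x(H) = Hom(𝒪_x^×, H)`, `H = ℤ/nℤ`, `n = q − 1`)]
[cite: Deitmar2006ZetaKTheoryF1, §2] -/
theorem card_points_of_dvd (F : Type*) [Field F] [Finite F] (hr : r ≠ 0)
    (h : r ∣ Nat.card F - 1) :
    Nat.card (CyclotomicLambdaRing r →+* F) = r := by
  rw [card_points_eq, card_rootsOfUnity_eq_gcd F hr]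
  exact Nat.gcd_eq_left h

/-- **Deitmar's Lemma 3 (mechanism)**: for every `r ≥ 1` there is `t ≥ 1` with
`gcd(r, 2^{jt+1} − 1) = 1` for all `j` ("Write `e = 2^k m` where `m` is odd … there are infinitely
many `n` such that `2ⁿ ≡ 2` modulo `m` and hence `2ⁿ − 1 ≡ 1` modulo `m`.  As `2ⁿ − 1` is odd, it
follows `(2ⁿ − 1, e) = 1`"; here `t = φ(m)` by Euler's theorem). [cite: Deitmar2006ZetaKTheoryF1, §2 Lemma 3] -/
theorem exists_coprime_two_pow_sub_one (hr : r ≠ 0) :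
    ∃ t : ℕ, 0 < t ∧ ∀ j : ℕ, Nat.Coprime r (2 ^ (j * t + 1) - 1) := by
  obtain ⟨k, m, hm, rfl⟩ := Nat.exists_eq_two_pow_mul_odd hr
  have hm0 : 0 < m := hm.pos
  refine ⟨Nat.totient m, Nat.totient_pos.mpr hm0, fun j => ?_⟩
  have h2m : Nat.Coprime 2 m := Nat.coprime_two_left.mpr hm
  -- `2^(j t) ≡ 1 [MOD m]` (Euler)
  have hpow : 2 ^ (j * Nat.totient m) ≡ 1 [MOD m] := by
    rw [mul_comm, pow_mul]
    simpa using (Nat.ModEq.pow_totient h2m).pow j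
  have hq1 : 1 ≤ 2 ^ (j * Nat.totient m + 1) := Nat.one_le_two_pow
  -- `q − 1 ≡ 1 [MOD m]` for `q = 2^(j t + 1)`
  have hmod : 2 ^ (j * Nat.totient m + 1) - 1 ≡ 1 [MOD m] := by
    refine Nat.ModEq.add_right_cancel' 1 ?_
    rw [Nat.sub_add_cancel hq1, pow_succ]
    exact hpow.mul_right 2
  -- `q − 1` is odd
  have hodd : Odd (2 ^ (j * Nat.totient m + 1) - 1) :=
    Nat.Even.sub_odd hq1 ((Nat.even_pow' (Nat.succ_ne_zero _)).mpr even_two) odd_one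
  refine Nat.Coprime.mul_left ?_ ?_
  · exact Nat.Coprime.pow_left k (Nat.coprime_two_left.mpr hodd)
  · rw [Nat.Coprime, Nat.gcd_comm, hmod.gcd_eq, Nat.gcd_one_left]

/-- **No counting polynomial for `gcd(r, q − 1)`** (`r ≥ 2`): there is no `N ∈ ℤ[x]` with
`N(q) = gcd(r, q − 1)` for every prime power `q` — `N` would equal `1` at the infinitely many
`q = 2^{jt+1}` of `exists_coprime_two_pow_sub_one`, hence `N = 1`, but `N(p^{φ(r)}) = r` for a prime
`p > r` (Euler: `r ∣ p^{φ(r)} − 1`). [cite: Deitmar2006ZetaKTheoryF1, Introduction ("Simple examples show that this is not the case") and §2 Lemma 3] -/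
theorem not_exists_polynomial_gcd (hr : 2 ≤ r) :
    ¬ ∃ N : ℤ[X], ∀ q : ℕ, IsPrimePow q → N.eval (q : ℤ) = (Nat.gcd r (q - 1) : ℤ) := by
  rintro ⟨N, hN⟩
  have hr0 : r ≠ 0 := by omega
  obtain ⟨t, ht, hcop⟩ := exists_coprime_two_pow_sub_one hr0
  -- `N` takes the value `1` at infinitely many integers
  have hinf : Set.Infinite {x : ℤ | N.eval x = (C (1 : ℤ)).eval x} := by
    have hmem : ∀ j : ℕ,
        ((2 ^ (j * t + 1) : ℕ) : ℤ) ∈ {x : ℤ | N.eval x = (C (1 : ℤ)).eval x} := by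
      intro j
      rw [Set.mem_setOf_eq, eval_C,
        hN _ ((Nat.prime_two.isPrimePow).pow (k := j * t + 1) (Nat.succ_ne_zero _))]
      exact_mod_cast (hcop j).gcd_eq_one
    refine Set.infinite_of_injective_forall_mem
      (f := fun j : ℕ => ((2 ^ (j * t + 1) : ℕ) : ℤ)) ?_ hmem
    intro i j hij
    dsimp only at hij
    have h1 : 2 ^ (i * t + 1) = 2 ^ (j * t + 1) := by exact_mod_cast hij
    have h2 : i * t + 1 = j * t + 1 := Nat.pow_right_injective (le_refl 2) h1
    exact Nat.eq_of_mul_eq_mul_right ht (by omega)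
  have hN1 : N = C 1 := Polynomial.eq_of_infinite_eval_eq _ _ hinf
  -- a prime power `q' = p^φ(r)` with `r ∣ q' − 1`
  obtain ⟨p, hpr, hp⟩ := Nat.exists_infinite_primes (r + 1)
  have hcp : Nat.Coprime p r :=
    (Nat.Prime.coprime_iff_not_dvd hp).mpr (Nat.not_dvd_of_pos_of_lt (by omega) (by omega))
  have hmod : p ^ Nat.totient r ≡ 1 [MOD r] := Nat.ModEq.pow_totient hcp
  have hq1 : 1 ≤ p ^ Nat.totient r := Nat.one_le_pow _ _ hp.pos
  have hdvd : r ∣ p ^ Nat.totient r - 1 := (Nat.modEq_iff_dvd' hq1).mp hmod.symm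
  have hφ : Nat.totient r ≠ 0 := (Nat.totient_pos.mpr (by omega : 0 < r)).ne'
  have hval := hN (p ^ Nat.totient r) ((hp.isPrimePow).pow (k := Nat.totient r) hφ)
  rw [Nat.gcd_eq_left hdvd, hN1, eval_C] at hval
  have : (r : ℤ) = 1 := hval.symm
  omega

/-- **`μ_r` (`r ≥ 2`) violates Soulé's condition**: there is no polynomial `N ∈ ℤ[x]` with
`#μ_r(𝔽) = #Hom(ℤ[μ_r], 𝔽) = N(#𝔽)` for every finite field `𝔽` ("Simple examples show that this
is not the case" — whence Deitmar's `(q − 1, e) = 1` form of the counting condition, with `e = r`,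
`N = 1` here, and Connes–Consani's torsion-free hypothesis in Thm. 4.10).  In particular the
counting function of this Λ-ring / `𝔽₁`-scheme is not a counting polynomial in the sense of
`AbsoluteZetaPolynomialCounting`. [cite: Deitmar2006ZetaKTheoryF1, Introduction and Thm. 1]
[cite: ConnesConsani2010SchemesF1, Def. 4.9 and Thm. 4.10 (torsion-free hypothesis)] -/
theorem not_exists_countingPolynomial (hr : 2 ≤ r) :
    ¬ ∃ N : ℤ[X], ∀ (F : Type) [Field F] [Finite F],
      N.eval (Nat.card F : ℤ) = Nat.card (CyclotomicLambdaRing r →+* F) := by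
  rintro ⟨N, hN⟩
  have hr0 : r ≠ 0 := by omega
  refine not_exists_polynomial_gcd hr ⟨N, fun q hq => ?_⟩
  obtain ⟨p, k, hp, hk, rfl⟩ := (isPrimePow_nat_iff _).mp hq
  haveI : Fact p.Prime := ⟨hp⟩
  have hcard : Nat.card (GaloisField p k) = p ^ k := GaloisField.card p k hk.ne'
  have h := hN (GaloisField p k)
  rw [card_points_eq, card_rootsOfUnity_eq_gcd _ hr0, hcard] at h
  exact h

end CyclotomicLambdaRing

end Literature.Barriers.RiemannHypothesis
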